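import Mathlib
import HarnessLib
import Literature.Analysis.FluidPDE.TaoCascadeODE
import Summits.NavierStokesRegularity.NavierStokesRegularity.Theorems.TrappingWindowRungThreeShadowingTransferCore

/-!
# Weighted shadowing of window pseudo-orbits by the certified exact truncated flow
(concrete layer for `TrappingWindowRungThree.ShadowingTransfer`, item stmt-NavierStokesRegularity-22924)

The window coordinates `(i, k)`, `i : Fin 4`, `k ∈ [-Kb, Ka]`, of a state `y : Fin 4 → ℤ → ℝ` are
packaged, with the certificate's per-shell weights `ω k > 0`, into the finite-dimensional sup-normed
space `Fin 4 → ↥(Finset.Icc (-Kb) Ka) → ℝ` via `y ↦ (i, k) ↦ y i k / ω k`, so that the weighted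
closeness clauses `|y i k - y' i k| ≤ d · ω k` of the exact-flow certificate become norm balls, and
the truncated quadratic cascade field `quadTerm 1 α (window-truncated y)` becomes a polynomial (hence
`C¹`, hence Lipschitz and bounded on balls) vector field.  `window_shadowing` then transports the
abstract tube-shadowing estimate `ShadowingTransfer.shadow_bootstrap` back to coordinates: a `C¹`
window pseudo-orbit `S` of the truncated field with shellwise defect `≤ δ · ω k` (whenever its window
obeys the sup bounds `M`), started on the certified exact orbit `x` (which stays
`M - Λ δ τs ω - mm` inside), satisfies `|S i k t - x i k t| ≤ Λ δ t · ω k` on `[0, Tm]`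
(`Tm ≤ τs`, `Λ δ τs < κ`), where `Λ` is the certificate's two-point flow-Lipschitz constant on the
`κ`-tube (clause TUBE, taken verbatim as a hypothesis).

HONEST FRAMING: finite-dimensional ODE bookkeeping for the MODEL-lattice route
`TrappingWindowRungThree` (rung TL-M3); nothing here is a statement about the Navier–Stokes
equations and NS regularity is NOT proved by anything in this file.
-/

noncomputable section

-- the sub-problem namespace repeats the summit name by design (D-0017)
set_option linter.dupNamespace false

namespace Summit.NavierStokesRegularity.NavierStokesRegularity.Theorems

namespace ShadowingTransfer

open Set Filter Topology NNReal Literature.Analysis.FluidPDE Literature.Analysis.FluidPDE.TaoCascade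

/-- `quadTerm` evaluated along a trajectory at time `t` only sees the time-`t` slice. [folklore] -/
theorem quadTerm_slice {m : ℕ} (ε₀ : ℝ) (α : Fin m → Fin m → Fin m → ℤ × ℤ × ℤ → ℝ)
    (X : Fin m → ℤ → ℝ → ℝ) (i : Fin m) (k : ℤ) (t : ℝ) :
    quadTerm ε₀ α X i k t = quadTerm ε₀ α (fun j n (_ : ℝ) => X j n t) i k 0 := by
  simp only [quadTerm]

/-- The quadratic cascade nonlinearity is `C¹` in any `C¹` family of coordinates (it is a
polynomial). [folklore] -/
theorem contDiff_quadTerm {F : Type*} [NormedAddCommGroup F] [NormedSpace ℝ F]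
    {m : ℕ} (ε₀ : ℝ) (α : Fin m → Fin m → Fin m → ℤ × ℤ × ℤ → ℝ)
    (P : F → Fin m → ℤ → ℝ) (hP : ∀ j n, ContDiff ℝ 1 (fun e => P e j n)) (i : Fin m) (k : ℤ) :
    ContDiff ℝ 1 (fun e => quadTerm ε₀ α (fun j n (_ : ℝ) => P e j n) i k 0) := by
  unfold quadTerm
  refine ContDiff.sum fun i₁ _ => ContDiff.sum fun i₂ _ => ContDiff.sum fun μ _ => ?_
  exact contDiff_const.mul ((hP _ _).mul (hP _ _))

/-- **Weighted shadowing of a window pseudo-orbit by the certified exact orbit.**  All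
hypotheses are clauses of the exact-flow certificate (`TUBE` verbatim, the in-bounds margin of
`EPOCH`) or properties of a `C¹` window trajectory of the defect inclusion (shellwise defect
`≤ δ · ω k` against the window-truncated field while the window obeys the sup bounds); the conclusion
is the shellwise shadowing bound `|S i k t - x i k t| ≤ Λ δ t · ω k` on `[0, Tm]`. [folklore] -/
theorem window_shadowing {Kb Ka : ℤ} {α : Fin 4 → Fin 4 → Fin 4 → ℤ × ℤ × ℤ → ℝ}
    {M ω : ℤ → ℝ} {κ Λ δ τs mm Tm τq τ : ℝ}
    (hω : ∀ k, 0 < ω k) (hΛ : 0 ≤ Λ) (hδ : 0 ≤ δ) (hτs : 0 < τs) (hgap : Λ * δ * τs < κ)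
    (hmm : 0 < mm) (hTmτs : Tm ≤ τs) (hTmq : Tm ≤ τq) (hTmτ : Tm ≤ τ)
    {x S S' : Fin 4 → ℤ → ℝ → ℝ}
    (hx : ∀ i k, -Kb ≤ k → k ≤ Ka → ∀ t ∈ Icc (0 : ℝ) τq,
      HasDerivWithinAt (x i k)
        (quadTerm 1 α (fun j' n s' => if -Kb ≤ n ∧ n ≤ Ka then x j' n s' else 0) i k t)
        (Icc 0 τq) t ∧ |x i k t| ≤ M k - Λ * δ * τs * ω k - mm)
    (hS : ∀ i k, -Kb ≤ k → k ≤ Ka → ∀ t ∈ Icc (0 : ℝ) τ,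
      HasDerivWithinAt (S i k) (S' i k t) (Icc 0 τ) t)
    (hdef : ∀ t ∈ Ico (0 : ℝ) Tm, (∀ i k, -Kb ≤ k → k ≤ Ka → |S i k t| ≤ M k) →
      ∀ i k, -Kb ≤ k → k ≤ Ka →
        |S' i k t - quadTerm 1 α (fun j' n s' => if -Kb ≤ n ∧ n ≤ Ka then S j' n s' else 0) i k t|
          ≤ δ * ω k)
    (h0 : ∀ i k, -Kb ≤ k → k ≤ Ka → S i k 0 = x i k 0)
    (htube : ∀ t ∈ Icc (0 : ℝ) τq, ∀ (z z' : Fin 4 → ℤ → ℝ) (d u : ℝ),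
      (∀ i k, -Kb ≤ k → k ≤ Ka → |z i k - x i k t| ≤ κ * ω k ∧ |z' i k - x i k t| ≤ κ * ω k ∧
        |z i k - z' i k| ≤ d * ω k) → 0 < u → u ≤ τs →
      ∃ y y' : Fin 4 → ℤ → ℝ → ℝ, ∀ i k, -Kb ≤ k → k ≤ Ka →
        y i k 0 = z i k ∧ y' i k 0 = z' i k ∧ ∀ t' ∈ Icc (0 : ℝ) u,
          HasDerivWithinAt (y i k)
            (quadTerm 1 α (fun j' n s' => if -Kb ≤ n ∧ n ≤ Ka then y j' n s' else 0) i k t')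
            (Icc 0 u) t' ∧
          HasDerivWithinAt (y' i k)
            (quadTerm 1 α (fun j' n s' => if -Kb ≤ n ∧ n ≤ Ka then y' j' n s' else 0) i k t')
            (Icc 0 u) t' ∧
          |y i k t'| ≤ M k ∧ |y' i k t'| ≤ M k ∧ |y i k t' - y' i k t'| ≤ Λ * d * ω k) :
    ∀ t ∈ Icc (0 : ℝ) Tm, ∀ i k, -Kb ≤ k → k ≤ Ka → |S i k t - x i k t| ≤ Λ * δ * t * ω k := by
  -- the weighted window coordinates
  set Ψ : (Fin 4 → ℤ → ℝ) → (Fin 4 → ↥(Finset.Icc (-Kb) Ka) → ℝ) :=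
    fun y i n => y i n.1 / ω n.1 with hΨ_def
  set Θ : (Fin 4 → ↥(Finset.Icc (-Kb) Ka) → ℝ) → (Fin 4 → ℤ → ℝ) :=
    fun e i k => if h : -Kb ≤ k ∧ k ≤ Ka then e i ⟨k, Finset.mem_Icc.mpr h⟩ * ω k else 0
    with hΘ_def
  set V : (Fin 4 → ↥(Finset.Icc (-Kb) Ka) → ℝ) → (Fin 4 → ↥(Finset.Icc (-Kb) Ka) → ℝ) :=
    fun e i n => quadTerm 1 α (fun j' n' (_ : ℝ) => Θ e j' n') i n.1 0 / ω n.1 with hV_def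
  set A : Set (Fin 4 → ↥(Finset.Icc (-Kb) Ka) → ℝ) := {e | ∀ i n, |e i n| ≤ M n.1 / ω n.1}
    with hA_def
  have hωnn : ∀ k, 0 ≤ ω k := fun k => (hω k).le
  have hwin : ∀ n : ↥(Finset.Icc (-Kb) Ka), -Kb ≤ (n : ℤ) ∧ (n : ℤ) ≤ Ka :=
    fun n => Finset.mem_Icc.mp n.2
  -- algebra of the packaging
  have hΘwin : ∀ e i k (h : -Kb ≤ k ∧ k ≤ Ka), Θ e i k = e i ⟨k, Finset.mem_Icc.mpr h⟩ * ω k := by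
    intro e i k h
    simp only [hΘ_def, dif_pos h]
  have hΘout : ∀ e i k, ¬ (-Kb ≤ k ∧ k ≤ Ka) → Θ e i k = 0 := by
    intro e i k h
    simp only [hΘ_def, dif_neg h]
  have hΘΨ : ∀ (y : Fin 4 → ℤ → ℝ) j' n',
      Θ (Ψ y) j' n' = if -Kb ≤ n' ∧ n' ≤ Ka then y j' n' else 0 := by
    intro y j' n'
    by_cases h : -Kb ≤ n' ∧ n' ≤ Ka
    · rw [if_pos h, hΘwin _ _ _ h]
      show y j' n' / ω n' * ω n' = y j' n'
      exact div_mul_cancel₀ _ (hω n').ne'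
    · rw [if_neg h, hΘout _ _ _ h]
  have hΨΘ : ∀ e, Ψ (Θ e) = e := by
    intro e
    funext i n
    show Θ e i n.1 / ω n.1 = e i n
    rw [hΘwin e i n.1 (hwin n)]
    exact mul_div_cancel_right₀ _ (hω _).ne'
  have hVΨ : ∀ (y : Fin 4 → ℤ → ℝ) i n, V (Ψ y) i n =
      quadTerm 1 α (fun j' n' (_ : ℝ) => if -Kb ≤ n' ∧ n' ≤ Ka then y j' n' else 0) i n.1 0
        / ω n.1 := by
    intro y i n
    simp only [hV_def, hΘΨ]
  -- sup-norm bookkeeping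
  have hcoord : ∀ (e : Fin 4 → ↥(Finset.Icc (-Kb) Ka) → ℝ) i n, |e i n| ≤ ‖e‖ := by
    intro e i n
    rw [← Real.norm_eq_abs]
    exact (norm_le_pi_norm (e i) n).trans (norm_le_pi_norm e i)
  have hnorm : ∀ (e : Fin 4 → ↥(Finset.Icc (-Kb) Ka) → ℝ) (C : ℝ), 0 ≤ C →
      (∀ i n, |e i n| ≤ C) → ‖e‖ ≤ C := by
    intro e C hC h
    refine (pi_norm_le_iff_of_nonneg hC).mpr fun i => (pi_norm_le_iff_of_nonneg hC).mpr fun n => ?_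
    rw [Real.norm_eq_abs]
    exact h i n
  -- `V` is a polynomial field: `C¹`, hence Lipschitz and bounded on a ball containing `A`
  have hΘcd : ∀ j' n', ContDiff ℝ 1
      (fun e : Fin 4 → ↥(Finset.Icc (-Kb) Ka) → ℝ => Θ e j' n') := by
    intro j' n'
    by_cases h : -Kb ≤ n' ∧ n' ≤ Ka
    · simp only [hΘ_def, dif_pos h]
      exact (contDiff_apply_apply ℝ ℝ j' (⟨n', Finset.mem_Icc.mpr h⟩ : ↥(Finset.Icc (-Kb) Ka))).mul
        contDiff_const
    · simp only [hΘ_def, dif_neg h]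
      exact contDiff_const
  have hVcd : ContDiff ℝ 1 V := by
    rw [hV_def]
    refine contDiff_pi.mpr fun i => contDiff_pi.mpr fun n => ?_
    exact (contDiff_quadTerm 1 α (fun e j' n' => Θ e j' n') hΘcd i n.1).div_const _
  set R₀ : ℝ := ∑ n : ↥(Finset.Icc (-Kb) Ka), |M n.1 / ω n.1| with hR₀_def
  have hR₀ : 0 ≤ R₀ := Finset.sum_nonneg fun n _ => abs_nonneg _
  have hAball : A ⊆ Metric.closedBall 0 R₀ := by
    intro e he
    rw [mem_closedBall_zero_iff]
    refine hnorm e R₀ hR₀ fun i n => (he i n).trans ((le_abs_self _).trans ?_)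
    exact Finset.single_le_sum (f := fun n : ↥(Finset.Icc (-Kb) Ka) => |M n.1 / ω n.1|)
      (fun n _ => abs_nonneg _) (Finset.mem_univ n)
  obtain ⟨K, hK⟩ := hVcd.contDiffOn.exists_lipschitzOnWith one_ne_zero (convex_closedBall 0 R₀)
    (isCompact_closedBall 0 R₀)
  have hKA : LipschitzOnWith K V A := hK.mono hAball
  obtain ⟨Vmax, hVmax'⟩ := (isCompact_closedBall (0 : Fin 4 → ↥(Finset.Icc (-Kb) Ka) → ℝ) R₀)
    |>.exists_bound_of_continuousOn hVcd.continuous.continuousOn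
  have hVmax : ∀ e ∈ A, ‖V e‖ ≤ Vmax := fun e he => hVmax' e (hAball he)
  -- the packaged trajectories
  set xψ : ℝ → (Fin 4 → ↥(Finset.Icc (-Kb) Ka) → ℝ) := fun t => Ψ (fun i k => x i k t)
    with hxψ_def
  set Sψ : ℝ → (Fin 4 → ↥(Finset.Icc (-Kb) Ka) → ℝ) := fun t => Ψ (fun i k => S i k t)
    with hSψ_def
  set S'ψ : ℝ → (Fin 4 → ↥(Finset.Icc (-Kb) Ka) → ℝ) := fun t => Ψ (fun i k => S' i k t)
    with hS'ψ_def
  have hΛδτ : 0 ≤ Λ * δ * τs := mul_nonneg (mul_nonneg hΛ hδ) hτs.le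
  have hxψ : ∀ t ∈ Icc (0 : ℝ) Tm, HasDerivWithinAt xψ (V (xψ t)) (Icc 0 Tm) t ∧ xψ t ∈ A := by
    intro t ht
    have htq : t ∈ Icc (0 : ℝ) τq := ⟨ht.1, ht.2.trans hTmq⟩
    refine ⟨hasDerivWithinAt_pi.mpr fun i => hasDerivWithinAt_pi.mpr fun n => ?_, fun i n => ?_⟩
    · simp only [hxψ_def]
      rw [hVΨ (fun i k => x i k t) i n, ← quadTerm_slice]
      exact ((hx i n.1 (hwin n).1 (hwin n).2 t htq).1.mono (Icc_subset_Icc_right hTmq)).div_const _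
    · simp only [hxψ_def, hΨ_def, abs_div, abs_of_pos (hω _)]
      refine div_le_div_of_nonneg_right ?_ (hωnn _)
      have h1 := (hx i n.1 (hwin n).1 (hwin n).2 t htq).2
      have h2 : 0 ≤ Λ * δ * τs * ω n.1 := mul_nonneg hΛδτ (hωnn _)
      linarith
  have hSψ : ∀ t ∈ Icc (0 : ℝ) Tm, HasDerivWithinAt Sψ (S'ψ t) (Icc 0 Tm) t := by
    intro t ht
    have htτ : t ∈ Icc (0 : ℝ) τ := ⟨ht.1, ht.2.trans hTmτ⟩
    refine hasDerivWithinAt_pi.mpr fun i => hasDerivWithinAt_pi.mpr fun n => ?_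
    simp only [hSψ_def, hS'ψ_def, hΨ_def]
    exact ((hS i n.1 (hwin n).1 (hwin n).2 t htτ).mono (Icc_subset_Icc_right hTmτ)).div_const _
  have hdefψ : ∀ t ∈ Ico (0 : ℝ) Tm, Sψ t ∈ A → ‖S'ψ t - V (Sψ t)‖ ≤ δ := by
    intro t ht hA
    have hM : ∀ i k, -Kb ≤ k → k ≤ Ka → |S i k t| ≤ M k := by
      intro i k hk1 hk2
      have h := hA i ⟨k, Finset.mem_Icc.mpr ⟨hk1, hk2⟩⟩
      simp only [hSψ_def, hΨ_def, abs_div, abs_of_pos (hω _)] at h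
      exact (div_le_div_iff_of_pos_right (hω k)).mp h
    refine hnorm _ δ hδ fun i n => ?_
    simp only [Pi.sub_apply, hSψ_def]
    rw [hVΨ (fun i k => S i k t) i n, ← quadTerm_slice]
    show |S' i n.1 t / ω n.1 - quadTerm 1 α
        (fun j' n' s' => if -Kb ≤ n' ∧ n' ≤ Ka then S j' n' s' else 0) i n.1 t / ω n.1| ≤ δ
    rw [← _root_.sub_div, abs_div, abs_of_pos (hω _), div_le_iff₀ (hω _)]
    exact hdef t ht hM i n.1 (hwin n).1 (hwin n).2
  -- the margin of the exact orbit inside the sup bounds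
  set m : ℝ := mm / (1 + ∑ n : ↥(Finset.Icc (-Kb) Ka), ω n.1) with hm_def
  have hsumω : 0 < 1 + ∑ n : ↥(Finset.Icc (-Kb) Ka), ω n.1 :=
    add_pos_of_pos_of_nonneg one_pos (Finset.sum_nonneg fun n _ => hωnn _)
  have hm : 0 < m := div_pos hmm hsumω
  have hmω : ∀ n : ↥(Finset.Icc (-Kb) Ka), m ≤ mm / ω n.1 := by
    intro n
    rw [hm_def]
    refine div_le_div_of_nonneg_left hmm.le (hω _) ?_
    have := Finset.single_le_sum (f := fun n : ↥(Finset.Icc (-Kb) Ka) => ω n.1)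
      (fun n _ => hωnn _) (Finset.mem_univ n)
    linarith
  have hinner : ∀ t ∈ Icc (0 : ℝ) Tm, ∀ z : Fin 4 → ↥(Finset.Icc (-Kb) Ka) → ℝ,
      ‖z - xψ t‖ < Λ * δ * τs + m → z ∈ A := by
    intro t ht z hz i n
    have htq : t ∈ Icc (0 : ℝ) τq := ⟨ht.1, ht.2.trans hTmq⟩
    have h1 : |z i n - x i n.1 t / ω n.1| < Λ * δ * τs + m := by
      have h := (hcoord (z - xψ t) i n).trans_lt hz
      simpa [hxψ_def, hΨ_def] using h
    have h2 := (hx i n.1 (hwin n).1 (hwin n).2 t htq).2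
    have h3 : |x i n.1 t| / ω n.1 ≤ M n.1 / ω n.1 - Λ * δ * τs - mm / ω n.1 := by
      rw [div_le_iff₀ (hω _)]
      have hω0 : ω n.1 ≠ 0 := (hω _).ne'
      have e : (M n.1 / ω n.1 - Λ * δ * τs - mm / ω n.1) * ω n.1 =
          M n.1 - Λ * δ * τs * ω n.1 - mm := by
        field_simp
      rw [e]
      exact h2
    have h4 : |z i n| ≤ |z i n - x i n.1 t / ω n.1| + |x i n.1 t| / ω n.1 := by
      have e : |x i n.1 t| / ω n.1 = |x i n.1 t / ω n.1| := by
        rw [abs_div, abs_of_pos (hω n.1)]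
      rw [e]
      have := abs_sub_abs_le_abs_sub (z i n) (x i n.1 t / ω n.1)
      linarith
    linarith [hmω n]
  have h0ψ : Sψ 0 = xψ 0 := by
    funext i n
    simp only [hSψ_def, hxψ_def, hΨ_def, h0 i n.1 (hwin n).1 (hwin n).2]
  -- the two-point flow clause, packaged
  have htubeψ : ∀ t ∈ Icc (0 : ℝ) Tm, ∀ z z' : Fin 4 → ↥(Finset.Icc (-Kb) Ka) → ℝ,
      ‖z - xψ t‖ ≤ κ → ‖z' - xψ t‖ ≤ κ →
      ∃ y y' : ℝ → (Fin 4 → ↥(Finset.Icc (-Kb) Ka) → ℝ), y 0 = z ∧ y' 0 = z' ∧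
        ∀ r ∈ Icc (0 : ℝ) τs,
          (HasDerivWithinAt y (V (y r)) (Icc 0 τs) r ∧ y r ∈ A) ∧
          (HasDerivWithinAt y' (V (y' r)) (Icc 0 τs) r ∧ y' r ∈ A) ∧
          ‖y r - y' r‖ ≤ Λ * ‖z - z'‖ := by
    intro t ht z z' hz hz'
    have htq : t ∈ Icc (0 : ℝ) τq := ⟨ht.1, ht.2.trans hTmq⟩
    have hcl : ∀ i k, -Kb ≤ k → k ≤ Ka → |Θ z i k - x i k t| ≤ κ * ω k ∧
        |Θ z' i k - x i k t| ≤ κ * ω k ∧ |Θ z i k - Θ z' i k| ≤ ‖z - z'‖ * ω k := by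
      intro i k hk1 hk2
      have hk : -Kb ≤ k ∧ k ≤ Ka := ⟨hk1, hk2⟩
      set n : ↥(Finset.Icc (-Kb) Ka) := ⟨k, Finset.mem_Icc.mpr hk⟩ with hn
      have e1 : ∀ w : Fin 4 → ↥(Finset.Icc (-Kb) Ka) → ℝ,
          Θ w i k - x i k t = (w i n - x i k t / ω k) * ω k := by
        intro w
        have hω0 : ω k ≠ 0 := (hω k).ne'
        rw [hΘwin w i k hk, ← hn]
        field_simp
      have e2 : Θ z i k - Θ z' i k = (z i n - z' i n) * ω k := by
        rw [hΘwin z i k hk, hΘwin z' i k hk, ← hn]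
        ring
      refine ⟨?_, ?_, ?_⟩
      · rw [e1, abs_mul, abs_of_pos (hω k)]
        refine mul_le_mul_of_nonneg_right ?_ (hωnn k)
        have h := hcoord (z - xψ t) i n
        simp only [hxψ_def, hΨ_def, Pi.sub_apply] at h
        exact h.trans hz
      · rw [e1, abs_mul, abs_of_pos (hω k)]
        refine mul_le_mul_of_nonneg_right ?_ (hωnn k)
        have h := hcoord (z' - xψ t) i n
        simp only [hxψ_def, hΨ_def, Pi.sub_apply] at h
        exact h.trans hz'
      · rw [e2, abs_mul, abs_of_pos (hω k)]
        exact mul_le_mul_of_nonneg_right (hcoord (z - z') i n) (hωnn k)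
    obtain ⟨y, y', hyy'⟩ := htube t htq (Θ z) (Θ z') ‖z - z'‖ τs hcl hτs le_rfl
    refine ⟨fun r => Ψ (fun i k => y i k r), fun r => Ψ (fun i k => y' i k r), ?_, ?_, ?_⟩
    · funext i n
      have h := (hyy' i n.1 (hwin n).1 (hwin n).2).1
      simp only [hΨ_def, h]
      have := congrFun (congrFun (hΨΘ z) i) n
      simpa [hΨ_def] using this
    · funext i n
      have h := (hyy' i n.1 (hwin n).1 (hwin n).2).2.1
      simp only [hΨ_def, h]
      have := congrFun (congrFun (hΨΘ z') i) n
      simpa [hΨ_def] using this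
    · intro r hr
      refine ⟨⟨hasDerivWithinAt_pi.mpr fun i => hasDerivWithinAt_pi.mpr fun n => ?_, fun i n => ?_⟩,
        ⟨hasDerivWithinAt_pi.mpr fun i => hasDerivWithinAt_pi.mpr fun n => ?_, fun i n => ?_⟩, ?_⟩
      · beta_reduce
        rw [hVΨ (fun i k => y i k r) i n, ← quadTerm_slice]
        exact ((hyy' i n.1 (hwin n).1 (hwin n).2).2.2 r hr).1.div_const _
      · simp only [hΨ_def, abs_div, abs_of_pos (hω _)]
        exact div_le_div_of_nonneg_right ((hyy' i n.1 (hwin n).1 (hwin n).2).2.2 r hr).2.2.1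
          (hωnn _)
      · beta_reduce
        rw [hVΨ (fun i k => y' i k r) i n, ← quadTerm_slice]
        exact ((hyy' i n.1 (hwin n).1 (hwin n).2).2.2 r hr).2.1.div_const _
      · simp only [hΨ_def, abs_div, abs_of_pos (hω _)]
        exact div_le_div_of_nonneg_right
          ((hyy' i n.1 (hwin n).1 (hwin n).2).2.2 r hr).2.2.2.1 (hωnn _)
      · refine hnorm _ _ (mul_nonneg hΛ (norm_nonneg _)) fun i n => ?_
        simp only [Pi.sub_apply, hΨ_def]
        rw [← _root_.sub_div, abs_div, abs_of_pos (hω _), div_le_iff₀ (hω _)]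
        exact ((hyy' i n.1 (hwin n).1 (hwin n).2).2.2 r hr).2.2.2.2
  -- the abstract bootstrap
  have hmain := shadow_bootstrap hKA hVmax hTmτs hΛ hδ hm hgap hxψ hSψ hdefψ hinner h0ψ htubeψ
  intro t ht i k hk1 hk2
  have h := (hcoord (Sψ t - xψ t) i ⟨k, Finset.mem_Icc.mpr ⟨hk1, hk2⟩⟩).trans (hmain t ht)
  simp only [hSψ_def, hxψ_def, Pi.sub_apply, hΨ_def] at h
  rw [← _root_.sub_div, abs_div, abs_of_pos (hω k), div_le_iff₀ (hω k)] at h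
  exact h

end ShadowingTransfer

end Summit.NavierStokesRegularity.NavierStokesRegularity.Theorems

end
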